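import Mathlib.MeasureTheory.Measure.Haar.InnerProductSpace
import Mathlib.MeasureTheory.Group.Measure
import Mathlib.GroupTheory.QuotientGroup.Basic
import HarnessLib

/-!
# Vitali's non-measurable set, in a form usable on `ℝⁿ`

`Literature/MeasureTheory/Lebesgue`: the classical construction of G. Vitali (1905) of a set of
reals which is not Lebesgue measurable (Wheeden–Zygmund, *Measure and Integral* (1977), Ch. 3
§6, Thm. (3.38) and Cor. (3.39), PDF pp. 53–55), packaged as the two properties that analysis
counterexamples actually use, for an arbitrary additive Haar measure `μ` on a
finite-dimensional real normed space `E` (Lebesgue measure on `ℝ`, on `EuclideanSpace ℝ ι`, …):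

* `Literature.MeasureTheory.Lebesgue.Vitali.exists_transversal`: for every window `(a, a + δ)` there is a set `V ⊆ (a, a + δ)`
  of reals meeting every coset of `ℚ` in exactly one point (choice of one representative per
  class of `x ∼ y :⟺ x - y ∈ ℚ`, Wheeden–Zygmund (3.38));
* `Literature.MeasureTheory.Lebesgue.Vitali.measure_eq_zero_of_subset_preimage`: if `ℓ : E →L[ℝ] ℝ` takes the value `1` at
  some vector `e`, every *measurable* subset of the "Vitali slab" `A = ℓ⁻¹(V)` is `μ`-null —
  its translates by `q • e`, `q ∈ ℚ ∩ (0, 1]`, are pairwise disjoint, of equal measure, and (after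
  intersecting with a ball) contained in a bounded set (Wheeden–Zygmund, proof of (3.38) via
  Lemma (3.37); here the elementary disjoint-translates count replaces the Steinhaus lemma);
* `Literature.MeasureTheory.Lebesgue.Vitali.measure_inter_ball_ne_zero`: `A` has positive outer measure in every ball
  `B(x₀, r)` once the window is `(ℓ x₀ - r/3, ℓ x₀ + r/3)` — the rational translates of
  `A ∩ B(x₀, r)` cover `B(x₀, r/3)` (Wheeden–Zygmund (3.39): the translates `E_r` cover the line);
* hence (`Literature.MeasureTheory.Lebesgue.Vitali.not_nullMeasurableSet_of_subset`) no set squeezed between `A ∩ B(x₀, r)` and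
  `A` is even *null*-measurable, and in particular (`exists_innerNull_not_nullMeasurableSet`,
  `exists_not_nullMeasurableSet_real`) non-(null-)measurable sets exist: Vitali's theorem.

The quantitative packaging (inner measure zero + positive outer measure near a prescribed point)
is what is needed to show that hypotheses phrased with *lower* Lebesgue integrals cannot detect
the perturbation `u ↦ u + 𝟙_A w` of a function, while Bochner integrals of the perturbed function
take the junk value `0` (see `Literature/Analysis/FluidPDE/DistributionalToWeakCounterexample`).

## Mathlib search

Mathlib (this pin) has the Vitali *covering* lemma (`Mathlib/MeasureTheory/Covering/Vitali`) but
no non-measurable set (`lean search 'non-?measurable set'`, `'¬ ?NullMeasurableSet'`,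
`exists_not_measurableSet`: no hits); its `Counterexamples/` directory is not part of the
library. Used from Mathlib: `QuotientAddGroup` (cosets of `ℚ` in `ℝ`), `exists_rat_btwn`,
`measure_preimage_add_right` (translation invariance, valid for all sets),
`measure_iUnion`, `ENNReal.tsum_const_eq_top_of_ne_zero`, `measure_ball_pos`,
`NullMeasurableSet.exists_measurable_subset_ae_eq`.

## References

* R. L. Wheeden, A. Zygmund, *Measure and Integral*, Marcel Dekker / CRC Press (1977), Ch. 3 §6,
  Lemma (3.37), Thm. (3.38) (Vitali), Cor. (3.39). [WheedenWheedenZygmund1977]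
* G. Vitali, *Sul problema della misura dei gruppi di punti di una retta*, Bologna (1905).
-/

noncomputable section

open MeasureTheory Set Filter Topology Metric

namespace Literature.MeasureTheory.Lebesgue.Vitali

/-! ### The transversal of `ℝ / ℚ` in a window -/

/-- The additive subgroup `ℚ ⊆ ℝ` (range of the canonical embedding), whose cosets are the
equivalence classes `E_x = {x + r : r ∈ ℚ}` of Wheeden–Zygmund (3.38). [cite: WheedenWheedenZygmund1977, Thm. (3.38)] -/
def ratRange : AddSubgroup ℝ :=
  (Rat.castHom ℝ).toAddMonoidHom.range

/-- Membership in `ratRange`: `x ∈ ℚ ⊆ ℝ` iff `x` is the cast of a rational. [folklore] -/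
theorem mem_ratRange_iff {x : ℝ} : x ∈ ratRange ↔ ∃ q : ℚ, (q : ℝ) = x := by
  simp [ratRange, AddMonoidHom.mem_range]

/-- **Vitali's transversal** (Wheeden–Zygmund (3.38), with the representatives chosen in a
prescribed window, as in Exercise 20 there): for every `a` and `δ > 0` there is a set
`V ⊆ (a, a + δ)` containing exactly one element of each coset `x + ℚ` — every real is `v + q` with
`v ∈ V`, `q ∈ ℚ`, and two elements of `V` differing by a rational are equal. Uses the axiom of
choice (one representative per class; each class is dense, so it meets the window). [cite: WheedenWheedenZygmund1977, Thm. (3.38)] -/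
theorem exists_transversal (a : ℝ) {δ : ℝ} (hδ : 0 < δ) :
    ∃ V : Set ℝ, V ⊆ Ioo a (a + δ) ∧ (∀ x : ℝ, ∃ v ∈ V, ∃ q : ℚ, x = v + q) ∧
      ∀ v ∈ V, ∀ w ∈ V, ∀ q : ℚ, w = v + q → w = v := by
  have hrep : ∀ c : ℝ ⧸ ratRange, ∃ v ∈ Ioo a (a + δ), (v : ℝ ⧸ ratRange) = c := by
    intro c
    induction c using QuotientAddGroup.induction_on with
    | H y =>
      obtain ⟨q, hq1, hq2⟩ := exists_rat_btwn (show a - y < a - y + δ by linarith)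
      refine ⟨y + q, ⟨by linarith, by linarith⟩, ?_⟩
      rw [QuotientAddGroup.eq, mem_ratRange_iff]
      exact ⟨-q, by push_cast; ring⟩
  choose f hf hfmk using hrep
  refine ⟨range f, ?_, ?_, ?_⟩
  · rintro _ ⟨c, rfl⟩
    exact hf c
  · intro x
    refine ⟨f x, ⟨(x : ℝ ⧸ ratRange), rfl⟩, ?_⟩
    have h := hfmk (x : ℝ ⧸ ratRange)
    rw [QuotientAddGroup.eq, mem_ratRange_iff] at h
    obtain ⟨q, hq⟩ := h
    exact ⟨q, by linarith⟩
  · rintro _ ⟨c, rfl⟩ _ ⟨c', rfl⟩ q h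
    have hcc : c' = c := by
      rw [← hfmk c', ← hfmk c, QuotientAddGroup.eq, mem_ratRange_iff]
      exact ⟨-q, by rw [h]; push_cast; ring⟩
    rw [hcc]

/-! ### Vitali slabs in a finite-dimensional space with a Haar measure -/

section Haar

variable {E : Type*} [NormedAddCommGroup E] [NormedSpace ℝ E] [MeasurableSpace E] [BorelSpace E]
  [FiniteDimensional ℝ E] (μ : Measure E) [μ.IsAddHaarMeasure]

/-- **Measurable subsets of a Vitali slab are null** (Wheeden–Zygmund, proof of (3.38): "either
`E` is not measurable or `|E| = 0`"). Let `V ⊆ ℝ` contain no two points differing by a non-zero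
rational, `ℓ : E →L[ℝ] ℝ` and `ℓ e = 1`. If `B ⊆ ℓ⁻¹(V)` is measurable then `μ B = 0`: for each
`n`, the translates of `B ∩ B̄(0, n)` by `(k+1)⁻¹ • e`, `k ∈ ℕ`, are pairwise disjoint (two of them
meeting would produce two points of `V` at rational distance `(j+1)⁻¹ - (k+1)⁻¹`), have the same
measure (translation invariance) and lie in `B̄(0, n + ‖e‖)`, which has finite measure. [cite: WheedenWheedenZygmund1977, Thm. (3.38)] -/
theorem measure_eq_zero_of_subset_preimage {V : Set ℝ}
    (hV : ∀ v ∈ V, ∀ w ∈ V, ∀ q : ℚ, w = v + q → w = v) (ℓ : E →L[ℝ] ℝ) {e : E} (he : ℓ e = 1)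
    {B : Set E} (hB : MeasurableSet B) (hBA : B ⊆ ℓ ⁻¹' V) : μ B = 0 := by
  suffices h : ∀ n : ℕ, μ (B ∩ closedBall 0 n) = 0 by
    have hcov : B ⊆ ⋃ n : ℕ, B ∩ closedBall (0 : E) n := fun x hx => by
      obtain ⟨n, hn⟩ := exists_nat_ge ‖x‖
      exact mem_iUnion.2 ⟨n, hx, mem_closedBall_zero_iff.2 hn⟩
    exact measure_mono_null hcov (measure_iUnion_null h)
  intro n
  set s := B ∩ closedBall (0 : E) n with hs
  have hsm : MeasurableSet s := hB.inter measurableSet_closedBall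
  -- the rational shifts `qₖ = (k+1)⁻¹ ∈ (0, 1]`
  set qk : ℕ → ℝ := fun k => ((k : ℝ) + 1)⁻¹ with hqk
  have hqk_pos : ∀ k, 0 < qk k := fun k => by positivity
  have hqk_le : ∀ k, qk k ≤ 1 := fun k => inv_le_one_of_one_le₀ (by linarith [k.cast_nonneg (α := ℝ)])
  have hqk_inj : Function.Injective qk := fun j k h => by
    have h' : (j : ℝ) + 1 = (k : ℝ) + 1 := inv_injective h
    exact_mod_cast (add_right_cancel h')
  have hqk_rat : ∀ k, ∃ q : ℚ, (q : ℝ) = qk k := fun k => ⟨((k : ℚ) + 1)⁻¹, by push_cast; rfl⟩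
  -- the translates `s + qₖ e`
  set T : ℕ → Set E := fun k => (fun x => x + -(qk k • e)) ⁻¹' s with hT
  have hTm : ∀ k, MeasurableSet (T k) := fun k => (measurable_add_const _) hsm
  have hTμ : ∀ k, μ (T k) = μ s := fun k => measure_preimage_add_right μ _ s
  have hdisj : Pairwise (Function.onFun Disjoint T) := by
    intro j k hjk
    rw [Function.onFun, Set.disjoint_left]
    intro x hxj hxk
    have hj : ℓ (x + -(qk j • e)) ∈ V := hBA hxj.1
    have hk : ℓ (x + -(qk k • e)) ∈ V := hBA hxk.1
    simp only [map_add, map_neg, map_smul, smul_eq_mul, he, mul_one] at hj hk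
    obtain ⟨a, ha⟩ := hqk_rat j
    obtain ⟨b, hb⟩ := hqk_rat k
    have hw := hV _ hj _ hk (a - b) (by push_cast; rw [ha, hb]; ring)
    exact hjk (hqk_inj (by linarith))
  have hsub : (⋃ k, T k) ⊆ closedBall (0 : E) (n + ‖e‖) := by
    intro x hx
    obtain ⟨k, hk⟩ := mem_iUnion.1 hx
    have h1 : x + -(qk k • e) ∈ closedBall (0 : E) n := hk.2
    rw [mem_closedBall_zero_iff] at h1 ⊢
    have h2 : ‖qk k • e‖ ≤ ‖e‖ := by
      rw [norm_smul, Real.norm_eq_abs, abs_of_pos (hqk_pos k)]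
      exact mul_le_of_le_one_left (norm_nonneg _) (hqk_le k)
    calc ‖x‖ = ‖(x + -(qk k • e)) + qk k • e‖ := by rw [neg_add_cancel_right]
      _ ≤ ‖x + -(qk k • e)‖ + ‖qk k • e‖ := norm_add_le _ _
      _ ≤ n + ‖e‖ := add_le_add h1 h2
  have hfin : μ (⋃ k, T k) < ⊤ := (measure_mono hsub).trans_lt measure_closedBall_lt_top
  have hsum : μ (⋃ k, T k) = ∑' k, μ (T k) := measure_iUnion hdisj hTm
  simp_rw [hTμ] at hsum
  by_contra hne
  rw [hsum, ENNReal.tsum_const_eq_top_of_ne_zero hne] at hfin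
  exact lt_irrefl _ hfin

omit [FiniteDimensional ℝ E] in
/-- **A Vitali slab has positive outer measure in every ball** (Wheeden–Zygmund (3.39): the
rational translates of the transversal cover the line). Let every real be `v + q` with `v ∈ V`,
`q ∈ ℚ`, let `ℓ e = 1` with `|ℓ x| ≤ ‖x‖`, `‖e‖ ≤ 1`, and let the window be
`V ⊆ (ℓ x₀ - r/3, ℓ x₀ + r/3)`. Then `μ (ℓ⁻¹(V) ∩ B(x₀, r)) ≠ 0` (outer measure): every
`x ∈ B(x₀, r/3)` is `y + q e` with `y = x - q e ∈ ℓ⁻¹(V) ∩ B(x₀, r)` and `q ∈ ℚ`, `|q| < 2r/3`, so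
`B(x₀, r/3)` is covered by countably many translates of `ℓ⁻¹(V) ∩ B(x₀, r)`, all of the same
(outer) measure. [cite: WheedenWheedenZygmund1977, Cor. (3.39)] -/
theorem measure_inter_ball_ne_zero {V : Set ℝ} (hcov : ∀ x : ℝ, ∃ v ∈ V, ∃ q : ℚ, x = v + q)
    (ℓ : E →L[ℝ] ℝ) {e : E} (he : ℓ e = 1) (hℓ : ∀ x, |ℓ x| ≤ ‖x‖) (he1 : ‖e‖ ≤ 1)
    {x₀ : E} {r : ℝ} (hr : 0 < r) (hVr : V ⊆ Ioo (ℓ x₀ - r / 3) (ℓ x₀ + r / 3)) :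
    μ (ℓ ⁻¹' V ∩ ball x₀ r) ≠ 0 := by
  intro h0
  set W := ℓ ⁻¹' V ∩ ball x₀ r with hW
  set P : ℚ → Set E := fun q => (fun x => x + -((q : ℝ) • e)) ⁻¹' W with hP
  have hPμ : ∀ q, μ (P q) = 0 := fun q => by rw [hP]; dsimp only; rw [measure_preimage_add_right]; exact h0
  have hcover : ball x₀ (r / 3) ⊆ ⋃ q, P q := by
    intro x hx
    obtain ⟨v, hv, q, hq⟩ := hcov (ℓ x)
    have hv' := hVr hv
    rw [mem_ball, dist_eq_norm] at hx
    have hlx : |ℓ x - ℓ x₀| < r / 3 := by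
      calc |ℓ x - ℓ x₀| = |ℓ (x - x₀)| := by rw [map_sub]
        _ ≤ ‖x - x₀‖ := hℓ _
        _ < r / 3 := hx
    have hq_abs : |(q : ℝ)| < 2 * r / 3 := by
      rw [abs_sub_lt_iff] at hlx
      rw [abs_lt]
      constructor <;> linarith [hv'.1, hv'.2]
    refine mem_iUnion.2 ⟨q, ?_, ?_⟩
    · show ℓ (x + -((q : ℝ) • e)) ∈ V
      have : ℓ (x + -((q : ℝ) • e)) = v := by
        simp only [map_add, map_neg, map_smul, smul_eq_mul, he, mul_one]; linarith
      rw [this]; exact hv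
    · rw [mem_ball, dist_eq_norm]
      calc ‖x + -((q : ℝ) • e) - x₀‖ = ‖(x - x₀) + -((q : ℝ) • e)‖ := by abel_nf
        _ ≤ ‖x - x₀‖ + ‖-((q : ℝ) • e)‖ := norm_add_le _ _
        _ = ‖x - x₀‖ + |(q : ℝ)| * ‖e‖ := by rw [norm_neg, norm_smul, Real.norm_eq_abs]
        _ ≤ ‖x - x₀‖ + |(q : ℝ)| * 1 := by gcongr
        _ < r / 3 + 2 * r / 3 * 1 := by gcongr
        _ = r := by ring
  have hnull : μ (ball x₀ (r / 3)) = 0 := measure_mono_null hcover (measure_iUnion_null hPμ)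
  exact (measure_ball_pos μ x₀ (by positivity : (0 : ℝ) < r / 3)).ne' hnull

end Haar

/-! ### Non-measurability -/

section Null

variable {α : Type*} [MeasurableSpace α] {μ : Measure α}

/-- **Inner measure zero and positive outer measure exclude null-measurability.** If every
measurable subset of `A` is `μ`-null and `μ (A ∩ W) ≠ 0` (outer measure), then no set `S` with
`A ∩ W ⊆ S ⊆ A` is null-measurable: a null-measurable `S` contains a measurable `M` with
`μ (S \ M) = 0`, and `M ⊆ A` forces `μ S = μ M = 0` (Wheeden–Zygmund (3.39), last step). [cite: WheedenWheedenZygmund1977, Cor. (3.39)] -/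
theorem not_nullMeasurableSet_of_subset {A W S : Set α}
    (hnull : ∀ B : Set α, MeasurableSet B → B ⊆ A → μ B = 0) (hpos : μ (A ∩ W) ≠ 0)
    (hWS : A ∩ W ⊆ S) (hSA : S ⊆ A) : ¬ NullMeasurableSet S μ := by
  intro hS
  obtain ⟨M, hMS, hM, hMae⟩ := hS.exists_measurable_subset_ae_eq
  have hS0 : μ S = 0 := by
    rw [← measure_congr hMae]
    exact hnull M hM (hMS.trans hSA)
  exact hpos (measure_mono_null hWS hS0)

end Null

section Package

variable {E : Type*} [NormedAddCommGroup E] [NormedSpace ℝ E] [MeasurableSpace E] [BorelSpace E]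
  [FiniteDimensional ℝ E] (μ : Measure E) [μ.IsAddHaarMeasure]

/-- **Vitali slab near a point** (Wheeden–Zygmund (3.38)–(3.39), packaged): for an additive Haar
measure `μ` on a finite-dimensional real normed space, a functional `ℓ` with `ℓ e = 1`,
`|ℓ x| ≤ ‖x‖`, `‖e‖ ≤ 1` (e.g. a coordinate of `ℝⁿ` and its unit vector), a point `x₀` and a
radius `r > 0`, there is a set `A` (the slab `ℓ⁻¹(V)` over a transversal in the window
`(ℓ x₀ - r/3, ℓ x₀ + r/3)`) all of whose measurable subsets are null, while no `S` with
`A ∩ B(x₀, r) ⊆ S ⊆ A` is null-measurable. [cite: WheedenWheedenZygmund1977, Thm. (3.38)–Cor. (3.39)] -/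
theorem exists_innerNull_not_nullMeasurableSet (ℓ : E →L[ℝ] ℝ) {e : E} (he : ℓ e = 1)
    (hℓ : ∀ x, |ℓ x| ≤ ‖x‖) (he1 : ‖e‖ ≤ 1) (x₀ : E) {r : ℝ} (hr : 0 < r) :
    ∃ A : Set E, (∀ B : Set E, MeasurableSet B → B ⊆ A → μ B = 0) ∧
      ∀ S : Set E, A ∩ ball x₀ r ⊆ S → S ⊆ A → ¬ NullMeasurableSet S μ := by
  obtain ⟨V, hVI, hcov, hV⟩ := exists_transversal (ℓ x₀ - r / 3) (δ := 2 * r / 3) (by positivity)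
  have hVI' : V ⊆ Ioo (ℓ x₀ - r / 3) (ℓ x₀ + r / 3) := by
    convert hVI using 2; ring
  refine ⟨ℓ ⁻¹' V, fun B hB hBA => measure_eq_zero_of_subset_preimage μ hV ℓ he hB hBA,
    fun S hWS hSA => ?_⟩
  exact not_nullMeasurableSet_of_subset
    (fun B hB hBA => measure_eq_zero_of_subset_preimage μ hV ℓ he hB hBA)
    (measure_inter_ball_ne_zero μ hcov ℓ he hℓ he1 hr hVI') hWS hSA

/-- **Vitali's theorem** (Wheeden–Zygmund, Thm. (3.38)): there is a set of reals which is not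
Lebesgue measurable — indeed not even null-measurable — all of whose measurable subsets are
null. [cite: WheedenWheedenZygmund1977, Thm. (3.38)] -/
theorem exists_not_nullMeasurableSet_real :
    ∃ A : Set ℝ, ¬ NullMeasurableSet A volume ∧
      ∀ B : Set ℝ, MeasurableSet B → B ⊆ A → volume B = 0 := by
  obtain ⟨A, hnull, hS⟩ := exists_innerNull_not_nullMeasurableSet (volume : Measure ℝ)
    (ContinuousLinearMap.id ℝ ℝ) (e := 1) rfl (fun x => by simp) (by simp) 0 zero_lt_one
  exact ⟨A, hS A inter_subset_left Subset.rfl, hnull⟩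

/-- **Vitali's theorem in `ℝⁿ`** (Wheeden–Zygmund, Ch. 3 §6, "the construction in `ℝⁿ`, `n > 1`,
is similar", Exercise 19): for a non-empty index type, `EuclideanSpace ℝ ι` contains a set which
is not null-measurable for Lebesgue measure and all of whose measurable subsets are null (the
slab over a Vitali set in the `i`-th coordinate). [cite: WheedenWheedenZygmund1977, Ch. 3 §6 Exercise 19] -/
theorem exists_not_nullMeasurableSet_euclideanSpace {ι : Type*} [Fintype ι] [DecidableEq ι]
    (i : ι) :
    ∃ A : Set (EuclideanSpace ℝ ι), ¬ NullMeasurableSet A volume ∧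
      ∀ B : Set (EuclideanSpace ℝ ι), MeasurableSet B → B ⊆ A → volume B = 0 := by
  obtain ⟨A, hnull, hS⟩ := exists_innerNull_not_nullMeasurableSet
    (volume : Measure (EuclideanSpace ℝ ι)) (EuclideanSpace.proj i)
    (e := EuclideanSpace.single i 1) (by simp) (fun x => by simpa using PiLp.norm_apply_le x i)
    (by simp) 0 zero_lt_one
  exact ⟨A, hS A inter_subset_left Subset.rfl, hnull⟩

end Package

end Literature.MeasureTheory.Lebesgue.Vitali
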